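import Literature.ModelTheory.ExponentialFields.OMinimalFinitenessLemma
import Literature.ModelTheory.ExponentialFields.OMinimalPregeometry
import Literature.ModelTheory.ExponentialFields.OMinimalMonotonicityReal
import HarnessLib

/-!
# Uniform finiteness of the boundaries of the fibres of a definable planar set

Topic `Literature/ModelTheory/ExponentialFields`.  The first consequence of the Finiteness
Lemma (L. van den Dries, *Tame topology and o-minimal structures* (1998), Ch. 3, (1.7);
`OMinimalFinitenessLemma.lean`) in the direction of the cell decomposition theorem: for a
definable `S ⊆ M²` in an o-minimal structure, the fibres `S_x ⊆ M` are finite unions of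
points and intervals, and **the number of boundary points of `S_x` is bounded independently
of `x`** — the set `bd₁(S) = {(x, y) : y ∈ bd(S_x)}` of van den Dries, Ch. 3, (2.14) is
definable and finite over `M`, so the Finiteness Lemma applies to it.  This is the planar
case `m = 1` of the uniform finiteness property (Ch. 3, (2.13); Knight–Pillay–Steinhorn,
*Definable sets in ordered structures II* (1986)), and, read over `ℝ`, the case `n = 1` of the
statement `OMinimalUniformFiniteness` (input (F)) of the TameDichotomy route of the
AnomalousDissipation summit, in exactly its shape (`real_card_le_of_subset_frontier_one`).

* `uniformFiniteness_boundary` — order form (boundary points: every open interval around the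
  point meets `S_x` and its complement);
* `uniformFiniteness_frontier` — the same with the topological frontier for the order
  topology (`mem_frontier_iff_forall_Ioo`);
* `real_card_le_of_subset_frontier_one` — over `ℝ`, for an o-minimal expansion `L` of the
  ordered field of reals and an `L`-definable `S ⊆ ℝ^{Fin 2}`: there is `N` such that every
  finite set of frontier points of a fibre `{t | Fin.snoc a t ∈ S}` (`a ∈ ℝ^{Fin 1}`) has at
  most `N` elements.

Nothing here is a named fact.

## References

* [Dries1998] L. van den Dries, *Tame topology and o-minimal structures*, London Math. Soc.
  Lecture Note Series 248, CUP 1998, Ch. 3, (1.7) and (2.13)–(2.14).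
* [KnightPillaySteinhorn1986] J. Knight, A. Pillay, C. Steinhorn, *Definable sets in ordered
  structures II*, Trans. AMS 295 (1986) 593–605.
-/

open Set FirstOrder FirstOrder.Language
open _root_.Filter _root_.Topology

namespace Literature.ModelTheory.ExponentialFields

universe u v

section General

variable {L : Language.{u, v}} {M : Type*} [L.Structure M] [LinearOrder M]
  [DenselyOrdered M] [NoMinOrder M] [NoMaxOrder M]

/-- **Uniform finiteness of boundary points of fibres** (van den Dries 1998, Ch. 3, (1.7)
applied to `bd₁(S)` as in (2.14)–(2.15)): for a definable `S ⊆ M²` in an o-minimal structure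
on a dense linear order without endpoints (`<` definable) there is `N ∈ ℕ` such that every
fibre `S_x` has at most `N` boundary points (points every open interval around which meets
both `S_x` and its complement). [cite: Dries1998, Ch. 3 (2.14)] -/
theorem uniformFiniteness_boundary (hO : L.IsOMinimal M)
    (hlt : (univ : Set M).Definable L {v : Fin 2 → M | v 0 < v 1})
    {S : M → M → Prop} (hS : (univ : Set M).Definable L {v : Fin 2 → M | S (v 0) (v 1)}) :
    ∃ N : ℕ, ∀ x, {y | ∀ c₁ c₂, c₁ < y → y < c₂ →
      (∃ t, c₁ < t ∧ t < c₂ ∧ S x t) ∧ (∃ t, c₁ < t ∧ t < c₂ ∧ ¬ S x t)}.ncard ≤ N := by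
  -- `bd₁(S)` is definable …
  have hA : (univ : Set M).Definable L {v : Fin 2 → M | ∀ c₁ c₂, c₁ < v 1 → v 1 < c₂ →
      (∃ t, c₁ < t ∧ t < c₂ ∧ S (v 0) t) ∧ (∃ t, c₁ < t ∧ t < c₂ ∧ ¬ S (v 0) t)} := by
    repeat (first
      | exact definable_setOf_lt hlt (definableFun_proj _) (definableFun_proj _)
      | exact definable_setOf_rel hS (definableFun_proj _) (definableFun_proj _)
      | refine definable_setOf_and ?_ ?_
      | refine definable_setOf_not ?_
      | refine definable_setOf_imp ?_ ?_
      | apply definable_setOf_forall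
      | apply definable_setOf_exists)
  -- … and finite over `M`
  have hfin : ∀ x, {y | ∀ c₁ c₂, c₁ < y → y < c₂ →
      (∃ t, c₁ < t ∧ t < c₂ ∧ S x t) ∧ (∃ t, c₁ < t ∧ t < c₂ ∧ ¬ S x t)}.Finite := by
    intro x
    have hSx : (univ : Set M).Definable₁ L {t | S x t} :=
      definable_setOf_rel hS (definableFun_const' _ x) (definableFun_proj (0 : Fin 1))
    exact finite_setOf_boundary (hO _ hSx)
  exact FinitenessLemma.finiteness_lemma hO hlt hA hfin

section Topology

variable [TopologicalSpace M] [OrderTopology M]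

omit [L.Structure M] [DenselyOrdered M] in
/-- In the order topology of a linear order without endpoints, a point lies in the frontier of
a set iff every open interval around it meets both the set and its complement (open
intervals form a neighbourhood basis). [folklore] -/
theorem mem_frontier_iff_forall_Ioo {s : Set M} {y : M} :
    y ∈ frontier s ↔ ∀ c₁ c₂, c₁ < y → y < c₂ →
      (∃ t, c₁ < t ∧ t < c₂ ∧ t ∈ s) ∧ (∃ t, c₁ < t ∧ t < c₂ ∧ t ∉ s) := by
  rw [frontier_eq_closure_inter_closure, mem_inter_iff,
    mem_closure_iff_nhds_basis (nhds_basis_Ioo y), mem_closure_iff_nhds_basis (nhds_basis_Ioo y)]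
  constructor
  · rintro ⟨h₁, h₂⟩ c₁ c₂ hc₁ hc₂
    obtain ⟨t, hts, ht⟩ := h₁ (c₁, c₂) ⟨hc₁, hc₂⟩
    obtain ⟨t', hts', ht'⟩ := h₂ (c₁, c₂) ⟨hc₁, hc₂⟩
    exact ⟨⟨t, ht.1, ht.2, hts⟩, ⟨t', ht'.1, ht'.2, hts'⟩⟩
  · intro h
    refine ⟨fun i hi => ?_, fun i hi => ?_⟩
    · obtain ⟨⟨t, ht₁, ht₂, hts⟩, -⟩ := h i.1 i.2 hi.1 hi.2
      exact ⟨t, hts, ht₁, ht₂⟩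
    · obtain ⟨-, t, ht₁, ht₂, hts⟩ := h i.1 i.2 hi.1 hi.2
      exact ⟨t, hts, ht₁, ht₂⟩

/-- **Uniform finiteness of the frontiers of fibres** (van den Dries 1998, Ch. 3, (1.7) with
(2.14); Knight–Pillay–Steinhorn 1986): for a definable `S ⊆ M²` in an o-minimal structure on
a dense linear order without endpoints with its order topology (`<` definable), the frontiers
of the fibres `S_x = {t | S x t}` are finite with boundedly many points. [cite: Dries1998, Ch. 3 (2.14)] -/
theorem uniformFiniteness_frontier (hO : L.IsOMinimal M)
    (hlt : (univ : Set M).Definable L {v : Fin 2 → M | v 0 < v 1})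
    {S : M → M → Prop} (hS : (univ : Set M).Definable L {v : Fin 2 → M | S (v 0) (v 1)}) :
    ∃ N : ℕ, ∀ x, (frontier {t | S x t}).Finite ∧ (frontier {t | S x t}).ncard ≤ N := by
  obtain ⟨N, hN⟩ := uniformFiniteness_boundary hO hlt hS
  have heq : ∀ x, frontier {t | S x t} = {y | ∀ c₁ c₂, c₁ < y → y < c₂ →
      (∃ t, c₁ < t ∧ t < c₂ ∧ S x t) ∧ (∃ t, c₁ < t ∧ t < c₂ ∧ ¬ S x t)} := fun x => by
    ext y
    exact mem_frontier_iff_forall_Ioo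
  refine ⟨N, fun x => ⟨?_, ?_⟩⟩
  · rw [heq x]
    have hSx : (univ : Set M).Definable₁ L {t | S x t} :=
      definable_setOf_rel hS (definableFun_const' _ x) (definableFun_proj (0 : Fin 1))
    exact finite_setOf_boundary (hO _ hSx)
  · rw [heq x]
    exact hN x

end Topology

end General

/-- **Uniform finiteness for definable families of subsets of the real line, one parameter**
(van den Dries 1998, Ch. 3, (1.7) with (2.14); the case `n = 1` of the statement
`OMinimalUniformFiniteness` of the AnomalousDissipation / TameDichotomy route, in its shape):
for an o-minimal expansion `L` of the ordered field of real numbers and an `L`-definable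
`S ⊆ ℝ^{Fin 2}` there is `N` such that for every `a ∈ ℝ^{Fin 1}` every finite set of frontier
points of the fibre `{t | Fin.snoc a t ∈ S}` has at most `N` elements. [cite: Dries1998, Ch. 3 (2.14)] -/
theorem real_card_le_of_subset_frontier_one (L : Language.{0, 0}) [L.Structure ℝ]
    (φ : Language.orderedRing →ᴸ L) [φ.IsExpansionOn ℝ] (hO : L.IsOMinimal ℝ)
    (S : Set (Fin (1 + 1) → ℝ)) (hS : (univ : Set ℝ).Definable L S) :
    ∃ N : ℕ, ∀ (a : Fin 1 → ℝ) (F : Finset ℝ),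
      (↑F ⊆ frontier {t : ℝ | Fin.snoc a t ∈ S}) → F.card ≤ N := by
  -- `S` as a binary relation
  have hsnoc : ∀ v : Fin (1 + 1) → ℝ, (Fin.snoc (![v 0] : Fin 1 → ℝ) (v 1) : Fin (1 + 1) → ℝ) = v := by
    intro v
    funext i
    refine Fin.lastCases ?_ (fun j => ?_) i
    · simp
    · rw [Fin.snoc_castSucc, Fin.fin_one_eq_zero j]
      rfl
  have hR : (univ : Set ℝ).Definable L
      {v : Fin 2 → ℝ | (Fin.snoc (![v 0] : Fin 1 → ℝ) (v 1) : Fin (1 + 1) → ℝ) ∈ S} := by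
    convert hS using 1
    ext v
    simp only [mem_setOf_eq, hsnoc v]
  obtain ⟨N, hN⟩ := uniformFiniteness_frontier
    (S := fun x t => (Fin.snoc (![x] : Fin 1 → ℝ) t : Fin (1 + 1) → ℝ) ∈ S) hO
    (definable_lt_of_expansion φ) hR
  refine ⟨N, fun a F hF => ?_⟩
  have ha : a = ![a 0] := by
    funext i
    rw [Fin.fin_one_eq_zero i]
    rfl
  obtain ⟨hfin, hle⟩ := hN (a 0)
  rw [ha] at hF
  calc F.card = (↑F : Set ℝ).ncard := (Set.ncard_coe_finset F).symm
    _ ≤ (frontier {t : ℝ | (Fin.snoc (![a 0] : Fin 1 → ℝ) t : Fin (1 + 1) → ℝ) ∈ S}).ncard :=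
        Set.ncard_le_ncard hF hfin
    _ ≤ N := hle

end Literature.ModelTheory.ExponentialFields
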